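/-
Copyright: harness cell hodgecm-mathlib. III-11c global road (A-p13 lead), piece (N1) — insurance draft by B-p04.
-/
import Literature.NumberTheory.QuadraticForms.GlobalSquareTheorem
import Literature.NumberTheory.QuadraticForms.LocalNormIndex
import Literature.NumberTheory.AdelicBaseChange.AdicCompletionDensity
import HarnessLib

/-!
# Simultaneous prescription of local square classes by a global element

(N1) `exists_isSquare_mul_algebraMap_and_forall_isSquare`: for a number field `F`, a finite place `𝔭`, a non-zero
`b ∈ F_𝔭` and a finite set `T` of finite places not containing `𝔭`, there is `β ∈ F`, `β ≠ 0`, with `b β ∈ F_𝔭²` and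
`β ∈ F_w²` for every `w ∈ T` — weak approximation (`denseRange_of_prodAlgebraMap`: `F` is dense in
`∏_{w ∈ T ∪ {𝔭}} F_w`) applied to the open target «`β` close to a global representative `β₀` of the square class of
`b` at `𝔭` (`exists_eq_algebraMap_mul_sq`), `β` close to `1` at `w ∈ T`», squares being open
(`isSquare_div_of_valued_sub_lt`, `isSquare_of_valued_sub_one_lt`: O'Meara 63:1b at every finite place).
-/

open scoped NumberField Topology

namespace Literature.NumberTheory.QuadraticForms

open NumberField IsDedekindDomain IsDedekindDomain.HeightOneSpectrum Literature.NumberTheory.AdelicBaseChange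

/-- An open ball `{y | v(y - x) < v(c)}` (`c ≠ 0`) is a neighbourhood of `x` in `F_w`. [folklore] -/
private theorem ball_mem_nhds_adicCompletion {F : Type} [Field F] [NumberField F] (w : HeightOneSpectrum (𝓞 F))
    (x c : w.adicCompletion F) (hc : c ≠ 0) :
    {y : w.adicCompletion F | Valued.v (y - x) < Valued.v c} ∈ 𝓝 x := by
  have hc' : Valued.v c ≠ 0 := (Valuation.ne_zero_iff _).mpr hc
  refine Valued.mem_nhds.mpr ⟨Units.mk0 (Valued.v.restrict c) ?_, fun y hy => ?_⟩
  · exact ((Valuation.restrict_pos_iff (v := Valued.v) c).mpr (zero_lt_iff.mpr hc')).ne'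
  · simp only [Set.mem_setOf_eq, Units.val_mk0] at hy ⊢
    exact (Valuation.restrict_lt_iff _).mp hy

/-- **(N1) Simultaneous local square classes.** For a finite place `𝔭` of a number field `F`, `b ∈ F_𝔭` non-zero and
a finite set `T ∌ 𝔭` of finite places, some non-zero `β ∈ F` has `b β` a square in `F_𝔭` and `β` a square in `F_w` for
every `w ∈ T` (weak approximation at the finitely many places `T ∪ {𝔭}` + openness of the local squares).
[cite: Omeara1963, §63A Cor. 63:1b; CasselsFrohlichANT1967, Ch. II §6 Lemma (weak approximation)] -/
theorem exists_isSquare_mul_algebraMap_and_forall_isSquare (F : Type) [Field F] [NumberField F]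
    (𝔭 : HeightOneSpectrum (𝓞 F)) {b : 𝔭.adicCompletion F} (hb : b ≠ 0)
    (T : Finset (HeightOneSpectrum (𝓞 F))) (hT : 𝔭 ∉ T) :
    ∃ β : F, β ≠ 0 ∧ IsSquare (b * algebraMap F (𝔭.adicCompletion F) β) ∧
      ∀ w ∈ T, IsSquare (algebraMap F (w.adicCompletion F) β) := by
  classical
  -- a global representative `β₀` of the square class of `b` at `𝔭`: `b = β₀ c²`
  obtain ⟨β₀, c, hc, -, hbc⟩ := exists_eq_algebraMap_mul_sq F 𝔭 b hb
  have hβ₀' : algebraMap F (𝔭.adicCompletion F) β₀ ≠ 0 := by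
    intro h; exact hb (by rw [hbc, h, zero_mul])
  have hβ₀ : β₀ ≠ 0 := by rintro rfl; exact hβ₀' (map_zero _)
  -- the finitely many places `S = T ∪ {𝔭}` and the global targets `t w` (`β₀` at `𝔭`, `1` on `T`)
  set S : Finset (HeightOneSpectrum (𝓞 F)) := insert 𝔭 T with hS
  let t : HeightOneSpectrum (𝓞 F) → F := fun w => if w = 𝔭 then β₀ else 1
  have ht0 : ∀ w, t w ≠ 0 := fun w => by
    by_cases h : w = 𝔭 <;> simp [t, h, hβ₀]
  let z : (i : ↥S) → i.1.adicCompletion F := fun i => algebraMap F (i.1.adicCompletion F) (t i.1)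
  have hz0 : ∀ i, z i ≠ 0 := fun i => by
    simpa only [z, ne_eq, map_eq_zero] using ht0 i.1
  -- the box `∏_{w ∈ S} {y | v_w(y - z_w) < v_w(4 z_w)}` is a neighbourhood of `z`
  have hbox : Set.pi Set.univ (fun i : ↥S => {y : i.1.adicCompletion F | Valued.v (y - z i) < Valued.v (4 * z i)})
      ∈ 𝓝 z := by
    refine set_pi_mem_nhds Set.finite_univ fun i _ => ball_mem_nhds_adicCompletion i.1 (z i) (4 * z i) ?_
    haveI : CharZero (i.1.adicCompletion F) := charZero_of_injective_algebraMap (algebraMap F _).injective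
    exact mul_ne_zero (by norm_num) (hz0 i)
  -- weak approximation: a global `β` in the box
  have hd : DenseRange (algebraMap F ((i : ↥S) → i.1.adicCompletion F)) :=
    denseRange_of_prodAlgebraMap F (valuation := fun i : ↥S => i.1) Subtype.val_injective
  obtain ⟨β, hβ⟩ := hd.mem_nhds hbox
  simp only [Set.mem_pi, Set.mem_univ, forall_const, Set.mem_setOf_eq] at hβ
  have hβw : ∀ i : ↥S, Valued.v (algebraMap F (i.1.adicCompletion F) β - z i) < Valued.v (4 * z i) := fun i => hβ i
  -- at `𝔭`: `β / β₀` is a square, so `b β = (β₀ c)² (β / β₀)` is a square, and `β ≠ 0`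
  have h𝔭S : 𝔭 ∈ S := Finset.mem_insert_self 𝔭 T
  have h𝔭 := hβw ⟨𝔭, h𝔭S⟩
  have hz𝔭 : z ⟨𝔭, h𝔭S⟩ = algebraMap F (𝔭.adicCompletion F) β₀ := by simp [z, t]
  rw [hz𝔭] at h𝔭
  have hβne : β ≠ 0 := by
    rintro rfl
    rw [map_zero, zero_sub, Valuation.map_neg, map_mul] at h𝔭
    have h4 : Valued.v (4 : 𝔭.adicCompletion F) ≤ 1 := by
      rw [show (4 : 𝔭.adicCompletion F) = 2 * 2 by norm_num, map_mul]
      exact mul_le_one' (valued_two_le_one _) (valued_two_le_one _)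
    exact (lt_irrefl _) (h𝔭.trans_le (mul_le_of_le_one_left zero_le h4))
  refine ⟨β, hβne, ?_, fun w hw => ?_⟩
  · obtain ⟨hsq, -⟩ := isSquare_div_of_valued_sub_lt F 𝔭 hβ₀' h𝔭
    have : b * algebraMap F (𝔭.adicCompletion F) β =
        (algebraMap F (𝔭.adicCompletion F) β₀ * c) ^ 2 *
          (algebraMap F (𝔭.adicCompletion F) β / algebraMap F (𝔭.adicCompletion F) β₀) := by
      rw [hbc]; field_simp
    rw [this]
    exact (IsSquare.sq _).mul hsq
  -- at `w ∈ T`: `β` is close to `1`, hence a square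
  · have hwS : w ∈ S := Finset.mem_insert_of_mem hw
    have hw𝔭 : w ≠ 𝔭 := fun h => hT (h ▸ hw)
    have hw' := hβw ⟨w, hwS⟩
    have hzw : z ⟨w, hwS⟩ = 1 := by simp [z, t, hw𝔭]
    rw [hzw, mul_one] at hw'
    exact isSquare_of_valued_sub_one_lt F w hw'

end Literature.NumberTheory.QuadraticForms
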